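import Summits.MatrixMultiplication.MatrixMultiplication.Theorems.SoloInformedTwistedMatchingsEffectivePrimePow
import HarnessLib

/-!
# Effective Theorem B″: certified exponents for hosts of exponent `5` and `9`

Solo-informed seat (MatrixMultiplication), gen 101; sharpest-statement §2y(8), effective form — two more
certified level conditions for `twistedMatching_card_le_effective_primePow`:
* exponent `5` (`p = 5`, `E = 1`, `u = 7/10`): `|ι| ≤ 3 |S|^{15/16}` (`θ_5(7/10) = 4.4616 = 5^{0.9294}`);
* exponent `9` (`p = 3`, `E = 2`, `u = 4/5`): `|ι| ≤ 3 |S|^{24/25}` (`θ_3(4/5) = 2.8314`, `θ_3(256/625) = 2.8602`,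
  both `≤ 3^{0.96} = 2.871`).
-/

noncomputable section

open scoped BigOperators
open Finset

namespace Summit.MatrixMultiplication.MatrixMultiplication.Theorems.TwistedSliceRank

section EffectiveConstantsB

/-- **Exponent-`5` hosts: `|ι| ≤ 3 |S|^{15/16}`** for every twisted matching under any finite family of
automorphism-pair twists. [this work] -/
theorem twistedMatching_card_le_exp_five (S : Type) [CommGroup S] [Fintype S] [DecidableEq S]
    (hexpS : ∀ g : S, g ^ 5 = 1) (σ : Type) [Fintype σ] (φ ψ : σ → S ≃* S) (ι : Type)
    [Fintype ι] (x y z : ι → S)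
    (hmatch : ∀ i j l : ι, (∃ s : σ, x i * φ s (y j) * ψ s (z l) = 1) ↔ (i = j ∧ j = l)) :
    (Fintype.card ι : ℝ) ≤ 3 * (Fintype.card S : ℝ) ^ (15 / 16 : ℝ) := by
  haveI : Fact (Nat.Prime 5) := ⟨Nat.prime_five⟩
  refine twistedMatching_card_le_effective_primePow 5 1 (7 / 10) (15 / 16) (by norm_num)
    (by norm_num) ?_ S (fun g => by simpa using hexpS g) σ φ ψ ι x y z hmatch
  intro s hs
  interval_cases s
  simp only [Fin.sum_univ_five, Fin.val_zero, Fin.val_one, Fin.val_two, Fin.isValue,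
    show ((3 : Fin 5) : ℕ) = 3 from rfl, show ((4 : Fin 5) : ℕ) = 4 from rfl]
  norm_num
  rw [show ((7 : ℝ) / 10) = ((10 : ℝ) / 7)⁻¹ by norm_num, Real.inv_rpow (by norm_num),
    Real.rpow_neg (by norm_num), inv_inv]
  have h48 : (((10 : ℝ) / 7) ^ ((4 : ℝ) / 3) * (27731 / 10000)) ^ (48 : ℕ) ≤
      ((5 : ℝ) ^ ((15 : ℝ) / 16)) ^ (48 : ℕ) := by
    rw [mul_pow, ← Real.rpow_natCast (((10 : ℝ) / 7) ^ ((4 : ℝ) / 3)) 48,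
      ← Real.rpow_mul (by norm_num), ← Real.rpow_natCast ((5 : ℝ) ^ ((15 : ℝ) / 16)) 48,
      ← Real.rpow_mul (by norm_num),
      show ((4 : ℝ) / 3 * ((48 : ℕ) : ℝ)) = ((64 : ℕ) : ℝ) by norm_num,
      show ((15 : ℝ) / 16 * ((48 : ℕ) : ℝ)) = ((45 : ℕ) : ℝ) by norm_num,
      Real.rpow_natCast, Real.rpow_natCast]
    norm_num
  have := le_of_pow_le_pow_left₀ (by norm_num) (by positivity) h48
  exact this

/-- **Exponent-`9` hosts: `|ι| ≤ 3 |S|^{24/25}`** for every twisted matching under any finite family of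
automorphism-pair twists. [this work] -/
theorem twistedMatching_card_le_exp_nine (S : Type) [CommGroup S] [Fintype S] [DecidableEq S]
    (hexpS : ∀ g : S, g ^ 9 = 1) (σ : Type) [Fintype σ] (φ ψ : σ → S ≃* S) (ι : Type)
    [Fintype ι] (x y z : ι → S)
    (hmatch : ∀ i j l : ι, (∃ s : σ, x i * φ s (y j) * ψ s (z l) = 1) ↔ (i = j ∧ j = l)) :
    (Fintype.card ι : ℝ) ≤ 3 * (Fintype.card S : ℝ) ^ (24 / 25 : ℝ) := by
  haveI : Fact (Nat.Prime 3) := ⟨Nat.prime_three⟩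
  refine twistedMatching_card_le_effective_primePow 3 2 (4 / 5) (24 / 25) (by norm_num)
    (by norm_num) ?_ S (fun g => by simpa using hexpS g) σ φ ψ ι x y z hmatch
  intro s hs
  interval_cases s
  · simp only [Fin.sum_univ_three, Fin.val_zero, Fin.val_one, Fin.val_two, Fin.isValue]
    norm_num
    rw [show ((4 : ℝ) / 5) = ((5 : ℝ) / 4)⁻¹ by norm_num, Real.inv_rpow (by norm_num),
      Real.rpow_neg (by norm_num), inv_inv]
    have h75 : (((5 : ℝ) / 4) ^ ((2 : ℝ) / 3) * (61 / 25)) ^ (75 : ℕ) ≤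
        ((3 : ℝ) ^ ((24 : ℝ) / 25)) ^ (75 : ℕ) := by
      rw [mul_pow, ← Real.rpow_natCast (((5 : ℝ) / 4) ^ ((2 : ℝ) / 3)) 75,
        ← Real.rpow_mul (by norm_num), ← Real.rpow_natCast ((3 : ℝ) ^ ((24 : ℝ) / 25)) 75,
        ← Real.rpow_mul (by norm_num),
        show ((2 : ℝ) / 3 * ((75 : ℕ) : ℝ)) = ((50 : ℕ) : ℝ) by norm_num,
        show ((24 : ℝ) / 25 * ((75 : ℕ) : ℝ)) = ((72 : ℕ) : ℝ) by norm_num,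
        Real.rpow_natCast, Real.rpow_natCast]
      norm_num
    have := le_of_pow_le_pow_left₀ (by norm_num) (by positivity) h75
    exact this
  · simp only [Fin.sum_univ_three, Fin.val_zero, Fin.val_one, Fin.val_two, Fin.isValue]
    norm_num
    rw [show ((4 : ℝ) / 5) = ((5 : ℝ) / 4)⁻¹ by norm_num, Real.inv_rpow (by norm_num),
      Real.rpow_neg (by norm_num), inv_inv]
    have h75 : (((5 : ℝ) / 4) ^ ((8 : ℝ) / 3) * (616161 / 390625)) ^ (75 : ℕ) ≤
        ((3 : ℝ) ^ ((24 : ℝ) / 25)) ^ (75 : ℕ) := by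
      rw [mul_pow, ← Real.rpow_natCast (((5 : ℝ) / 4) ^ ((8 : ℝ) / 3)) 75,
        ← Real.rpow_mul (by norm_num), ← Real.rpow_natCast ((3 : ℝ) ^ ((24 : ℝ) / 25)) 75,
        ← Real.rpow_mul (by norm_num),
        show ((8 : ℝ) / 3 * ((75 : ℕ) : ℝ)) = ((200 : ℕ) : ℝ) by norm_num,
        show ((24 : ℝ) / 25 * ((75 : ℕ) : ℝ)) = ((72 : ℕ) : ℝ) by norm_num,
        Real.rpow_natCast, Real.rpow_natCast]
      norm_num
    have := le_of_pow_le_pow_left₀ (by norm_num) (by positivity) h75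
    exact this

end EffectiveConstantsB

end Summit.MatrixMultiplication.MatrixMultiplication.Theorems.TwistedSliceRank
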